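import Literature.NumberTheory.Automorphic.SelfDualLatticeCountFrameTransportCM      -- ★ FILE A∕B: `ncard_selfDualStable_congr`, `σ_w`-fixed uniformizer `ϖ_v`
import Literature.NumberTheory.Automorphic.ValuedFieldValuativeRelBridge             -- ★ `v_eq_iff_valuation_eq`
import HarnessLib

/-!
# The isotropic CYCLIC frame of an irreducible element of `U(Φ₂)(L_w)`: `P = (e₀ | g e₀)`, `P⁻¹ g P = C(tr g, det g)`, `H_P = antidiag(β, σβ)`, `v(β) ∈ {v(1), v(ϖ)}`,
# and the transported self-dual lattice count (Flicker 1998, p. 97; Rogawski 1990, §3.6 p. 31)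

Topic `NumberTheory/Automorphic`; namespace `Literature.NumberTheory.Automorphic.UnitaryGroup`.  THEOREMS ONLY (no definition, no instance, no notation, no named fact,
no `sorry`; count-neutral).  Cell `pub/hodgecm-mathlib`, F0∕P3a road «D-N7-inert», line «N7nsCount» (`stub_irredHValue` of ED. 1.3; architect A-p06 (g26)), brick
**(F11-d)(β0′) «ISOTROPIC CYCLIC FRAME AT THE CM PLACE»** of B-p10 (g24)'s type-(2) H-side count (his ★-bound (β2′-ii) `ncard_selfDualStable_antidiag_companion_eq_sum`
counts in the frame produced here).  HONEST LABEL: HC_CM is proved only modulo the printed citations until rung 0 closes; linear algebra here.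

THE MATHEMATICS.  `K = L_w`, `σ = σ_w`, `Φ₂ = antidiag(1, 1)`, `γ ∈ U(σ, Φ₂)(K)` whose characteristic polynomial `X² − tX + d` has NO ROOT in `K`.  Then `e₀ = (1, 0)ᵀ` is not
an eigenvector, i.e. `β := γ₁₀ ≠ 0`, and `P := (e₀ | γ e₀) = [[1, γ₀₀], [0, γ₁₀]]` is invertible with **`γ P = P · C`**, `C = [[0, −d], [1, t]]` (Cayley–Hamilton).  Since
`e₀` is ISOTROPIC for `Φ₂` and `⟨γe₀, γe₀⟩ = ⟨e₀, e₀⟩ = 0` (unitarity), **`H_P = ᵗσ(P) Φ₂ P = [[0, β], [σβ, 0]]`**, and unitarity of `γ` (both `ᵗσγ Φ₂ γ = Φ₂` and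
`γ Φ₂ ᵗσγ = Φ₂`) gives the trace relation **`β σ(t) + σ(β) t = 0`**.  Replacing `e₀` by `ϖ_v^m e₀` (`ϖ_v` a `σ_w`-FIXED uniformizer, ★ `galAdicCompletionMap_toPlace_self`)
multiplies `β` by `ϖ_v^{2m}`, so one may take **`v(β) = v(ϖ_v^e)`, `e ∈ {0, 1}`** (the parity of `ord β`).  Finally ★ FILE A `ncard_selfDualStable_congr` transports the
count of `γ`-stable `Φ₂`-self-dual lattices to the frame `P`: **`#S(Φ₂, γ) = #S(antidiag(β, σβ), C)`** (**`exists_cyclicFrame_ncard_selfDualStable_eq`**).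

## References
* [Flicker1998UnitaryFL] Y. Z. Flicker, *Elementary proof of the fundamental lemma for a unitary group*, Canad. J. Math. 50 (1998), p. 97 (`Φ_H(t)`, `T_H ≃ (EL)¹ × E¹`).
* [Rogawski1990] J. D. Rogawski, *Automorphic Representations of Unitary Groups in Three Variables*, Ann. of Math. Stud. 123 (1990), §3.6 p. 31, §3.1 p. 19.
* [HornJohnson2013] R. A. Horn, C. R. Johnson, *Matrix Analysis*, 2nd ed. (2013), §3.3 (companion matrix of a cyclic vector).
-/

set_option autoImplicit false

noncomputable section

open scoped ValuativeRel Matrix MatrixGroups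
open Set Matrix NumberField IsDedekindDomain Polynomial ValuativeRel

namespace Literature.NumberTheory.Automorphic.UnitaryGroup

open Literature.NumberTheory.Rogawski1990 Literature.NumberTheory.GaloisRepresentations Literature.AlgebraicGeometry.ShimuraVarieties

/-! ## §1 Over a field: the cyclic frame of a rootless `2 × 2` element, its companion form, and the isotropic Gram matrix for `Φ₂` -/

section Field

variable {K : Type*} [Field K] (σ : K →+* K)

/-- **`e₀` is not an eigenvector**: if `χ_γ` has no root then `γ₁₀ ≠ 0` (else `γ₀₀` is a root: `χ_γ(γ₀₀) = −γ₀₁γ₁₀`). [cite: HornJohnson2013, §3.3] -/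
theorem apply_one_zero_ne_zero_of_not_exists_isRoot (γ : Matrix (Fin 2) (Fin 2) K) (hirr : ¬ ∃ x : K, γ.charpoly.IsRoot x) : γ 1 0 ≠ 0 := by
  intro h0
  refine hirr ⟨γ 0 0, ?_⟩
  rw [Polynomial.IsRoot.def, Matrix.charpoly_fin_two, Matrix.trace_fin_two, Matrix.det_fin_two]
  simp only [eval_add, eval_sub, eval_mul, eval_pow, eval_C, eval_X, h0]
  ring

/-- **THE CYCLIC FRAME**: `P = (e₀ | γ e₀) = [[1, γ₀₀], [0, γ₁₀]]` satisfies `γ P = P · [[0, −det γ], [1, tr γ]]` (Cayley–Hamilton for `2 × 2`). [cite: HornJohnson2013, §3.3] -/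
theorem mul_cyclicFrame_eq_mul_companion (γ : Matrix (Fin 2) (Fin 2) K) :
    γ * !![1, γ 0 0; 0, γ 1 0] = !![1, γ 0 0; 0, γ 1 0] * !![0, -γ.det; 1, γ.trace] := by
  rw [Matrix.trace_fin_two, Matrix.det_fin_two]
  ext i j
  fin_cases i <;> fin_cases j <;> simp [Matrix.mul_apply, Fin.sum_univ_two] <;> ring

/-- **THE GRAM MATRIX OF THE CYCLIC FRAME FOR `Φ₂` IS `antidiag(β, σβ)`**, `β = γ₁₀`, when `γ ∈ U(σ, Φ₂)`: `e₀` is isotropic and `⟨γe₀, γe₀⟩ = ⟨e₀, e₀⟩ = 0` (the `(0,0)`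
entry of `ᵗσγ Φ₂ γ = Φ₂`). [cite: Rogawski1990, §3.6 p. 31; §3.1 p. 19] -/
theorem formCongr_cyclicFrame_eq_antidiag {γ : Matrix (Fin 2) (Fin 2) K}
    (hγ : (γ.map σ)ᵀ * (Matrix.of fun i j : Fin 2 => if i.val + j.val + 1 = 2 then (1 : K) else 0) * γ =
      Matrix.of fun i j : Fin 2 => if i.val + j.val + 1 = 2 then (1 : K) else 0) :
    ((!![1, γ 0 0; 0, γ 1 0] : Matrix (Fin 2) (Fin 2) K).map σ)ᵀ * (Matrix.of fun i j : Fin 2 => if i.val + j.val + 1 = 2 then (1 : K) else 0) *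
        !![1, γ 0 0; 0, γ 1 0] = !![0, γ 1 0; σ (γ 1 0), 0] := by
  -- the `(0,0)` entry of unitarity: `σ(γ₀₀) γ₁₀ + σ(γ₁₀) γ₀₀ = 0`
  have h00 := congrFun (congrFun hγ 0) 0
  simp [Matrix.mul_apply, Fin.sum_univ_two, Matrix.of_apply] at h00
  ext i j
  fin_cases i <;> fin_cases j <;> simp [Matrix.mul_apply, Fin.sum_univ_two, Matrix.of_apply]
  linear_combination h00

/-- **THE TRACE RELATION `β σ(t) + σ(β) t = 0`** for `γ ∈ U(σ, Φ₂)`, `β = γ₁₀`, `t = tr γ`: the `(0,0)` entry of `ᵗσγ Φ₂ γ = Φ₂` gives `σ(γ₀₀)γ₁₀ + σ(γ₁₀)γ₀₀ = 0` and the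
`(1,1)` entry of `γ Φ₂ ᵗσγ = Φ₂` (unitarity of `γ⁻¹ = Φ₂ ᵗσγ Φ₂`) gives `γ₁₁ σ(γ₁₀) + γ₁₀ σ(γ₁₁) = 0`. [cite: Rogawski1990, §3.1 p. 19] -/
theorem apply_mul_map_trace_add_eq_zero {γ : Matrix (Fin 2) (Fin 2) K}
    (hγ : (γ.map σ)ᵀ * (Matrix.of fun i j : Fin 2 => if i.val + j.val + 1 = 2 then (1 : K) else 0) * γ =
      Matrix.of fun i j : Fin 2 => if i.val + j.val + 1 = 2 then (1 : K) else 0) :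
    γ 1 0 * σ γ.trace + σ (γ 1 0) * γ.trace = 0 := by
  set Φ : Matrix (Fin 2) (Fin 2) K := Matrix.of fun i j : Fin 2 => if i.val + j.val + 1 = 2 then (1 : K) else 0 with hΦ
  have hΦΦ : Φ * Φ = 1 := by
    ext i j; fin_cases i <;> fin_cases j <;> simp [hΦ, Matrix.mul_apply, Fin.sum_univ_two, Matrix.of_apply]
  -- `γ Φ ᵗσγ = Φ`
  have h1 : (Φ * (γ.map σ)ᵀ * Φ) * γ = 1 := by
    rw [Matrix.mul_assoc, Matrix.mul_assoc, ← Matrix.mul_assoc ((γ.map σ)ᵀ), hγ, hΦΦ]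
  have h2 : γ * (Φ * (γ.map σ)ᵀ * Φ) = 1 := mul_eq_one_comm.1 h1
  have h3 : γ * Φ * (γ.map σ)ᵀ = Φ := by
    have h := congrArg (· * Φ) h2
    simp only [Matrix.mul_assoc, hΦΦ, Matrix.mul_one, Matrix.one_mul] at h
    rw [← Matrix.mul_assoc] at h
    exact h
  have h00 := congrFun (congrFun hγ 0) 0
  have h11 := congrFun (congrFun h3 1) 1
  simp [hΦ, Matrix.mul_apply, Fin.sum_univ_two, Matrix.of_apply] at h00 h11
  rw [Matrix.trace_fin_two, map_add]
  linear_combination h00 + h11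

/-- **THE RESCALED CYCLIC FRAME over a valued field** (`σ`-fixed uniformizer `ϖ`, `v(ϖ) = exp(−1)`): for `γ ∈ U(σ, Φ₂)` (`Φ₂ = antidiag(1,1)`) with rootless `χ_γ` there are
`P ∈ GL₂(K)`, `β ≠ 0`, `e ∈ {0,1}` with `P⁻¹γP` the companion `[[0, −det γ], [1, tr γ]]`, `ᵗσ(P) Φ₂ P = antidiag(β, σβ)`, `v(β) = v(ϖ^e)`, `β σ(tr γ) + σ(β) tr γ = 0`,
and the transported count `#S(Φ₂, γ) = #S(antidiag(β, σβ), P⁻¹γP)` (★ `ncard_selfDualStable_congr`). [cite: Rogawski1990, §3.6 p. 31] [cite: HornJohnson2013, §3.3] -/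
theorem exists_cyclicFrame_ncard_selfDualStable_eq_of_uniformizer {F : Type*} [Field F] [ValuativeRel F] (τ : F →+* F) {ϖ : F} (hτϖ : τ ϖ = ϖ)
    (hϖ0 : ϖ ≠ 0) (hunif : ∀ x : F, x ≠ 0 → ∃ k : ℤ, valuation F x = valuation F (ϖ ^ k)) (γ : GL (Fin 2) F)
    (hγ : γ ∈ unitaryGroup τ (Matrix.of fun i j : Fin 2 => if i.val + j.val + 1 = 2 then (1 : F) else 0))
    (hirr : ¬ ∃ x : F, ((γ : Matrix (Fin 2) (Fin 2) F).charpoly).IsRoot x) :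
    ∃ (P γ' : GL (Fin 2) F) (β : F) (e : ℕ),
      β ≠ 0 ∧ e ≤ 1 ∧ γ' = P⁻¹ * γ * P ∧
      (γ' : Matrix (Fin 2) (Fin 2) F) = !![0, -(γ : Matrix (Fin 2) (Fin 2) F).det; 1, (γ : Matrix (Fin 2) (Fin 2) F).trace] ∧
      formCongr τ P (Matrix.of fun i j : Fin 2 => if i.val + j.val + 1 = 2 then (1 : F) else 0) = !![0, β; τ β, 0] ∧
      valuation F β = valuation F (ϖ ^ e) ∧
      β * τ (γ : Matrix (Fin 2) (Fin 2) F).trace + τ β * (γ : Matrix (Fin 2) (Fin 2) F).trace = 0 ∧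
      {Λ : Submodule 𝒪[F] (Fin 2 → F) |
          (∃ g : GL (Fin 2) F, (∃ J' ∈ glInt 2 F, (J' : Matrix (Fin 2) (Fin 2) F) =
              formCongr τ g (Matrix.of fun i j : Fin 2 => if i.val + j.val + 1 = 2 then (1 : F) else 0)) ∧
            Λ = Submodule.span 𝒪[F] (Set.range ((g : Matrix (Fin 2) (Fin 2) F))ᵀ)) ∧
          Λ.map ((Matrix.toLin' ((γ : GL (Fin 2) F) : Matrix (Fin 2) (Fin 2) F)).restrictScalars 𝒪[F]) = Λ}.ncard =
      {Λ : Submodule 𝒪[F] (Fin 2 → F) |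
          (∃ g : GL (Fin 2) F, (∃ J' ∈ glInt 2 F, (J' : Matrix (Fin 2) (Fin 2) F) = formCongr τ g !![0, β; τ β, 0]) ∧
            Λ = Submodule.span 𝒪[F] (Set.range ((g : Matrix (Fin 2) (Fin 2) F))ᵀ)) ∧
          Λ.map ((Matrix.toLin' ((γ' : GL (Fin 2) F) : Matrix (Fin 2) (Fin 2) F)).restrictScalars 𝒪[F]) = Λ}.ncard := by
  -- parity of `ord γ₁₀`: `v(γ₁₀) = v(ϖ^k)`, `k = 2m + e`
  have hc : (γ : Matrix (Fin 2) (Fin 2) F) 1 0 ≠ 0 := apply_one_zero_ne_zero_of_not_exists_isRoot _ hirr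
  obtain ⟨k, hk⟩ := hunif _ hc
  obtain ⟨m, e, he1, hme⟩ : ∃ (m : ℤ) (e : ℕ), e ≤ 1 ∧ k = 2 * m + (e : ℤ) := by
    rcases Int.emod_two_eq_zero_or_one k with h | h
    · exact ⟨k / 2, 0, zero_le_one, by omega⟩
    · exact ⟨k / 2, 1, le_rfl, by omega⟩
  have hAu := mem_unitaryGroup_iff.1 hγ
  have hlam0 : ϖ ^ (-m) ≠ 0 := zpow_ne_zero _ hϖ0
  have hτlam : τ (ϖ ^ (-m)) = ϖ ^ (-m) := by rw [map_zpow₀, hτϖ]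
  have hPdet : ((ϖ ^ (-m)) • (!![1, (γ : Matrix (Fin 2) (Fin 2) F) 0 0; 0, (γ : Matrix (Fin 2) (Fin 2) F) 1 0] : Matrix (Fin 2) (Fin 2) F)).det ≠ 0 := by
    rw [Matrix.det_smul, Matrix.det_fin_two, Fintype.card_fin]
    simp only [of_apply, cons_val', cons_val_zero, cons_val_one, cons_val_fin_one, empty_val', one_mul, mul_zero, sub_zero]
    exact mul_ne_zero (pow_ne_zero _ hlam0) hc
  let P : GL (Fin 2) F := Matrix.GeneralLinearGroup.mkOfDetNeZero _ hPdet
  have hP : (P : Matrix (Fin 2) (Fin 2) F) = (ϖ ^ (-m)) • !![1, (γ : Matrix (Fin 2) (Fin 2) F) 0 0; 0, (γ : Matrix (Fin 2) (Fin 2) F) 1 0] := rfl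
  have hβ0 : ϖ ^ (-m) * ϖ ^ (-m) * (γ : Matrix (Fin 2) (Fin 2) F) 1 0 ≠ 0 := mul_ne_zero (mul_ne_zero hlam0 hlam0) hc
  have hcomp : (γ : Matrix (Fin 2) (Fin 2) F) * ((ϖ ^ (-m)) • !![1, (γ : Matrix (Fin 2) (Fin 2) F) 0 0; 0, (γ : Matrix (Fin 2) (Fin 2) F) 1 0]) =
      ((ϖ ^ (-m)) • !![1, (γ : Matrix (Fin 2) (Fin 2) F) 0 0; 0, (γ : Matrix (Fin 2) (Fin 2) F) 1 0]) *
        !![0, -(γ : Matrix (Fin 2) (Fin 2) F).det; 1, (γ : Matrix (Fin 2) (Fin 2) F).trace] := by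
    rw [Matrix.mul_smul, Matrix.smul_mul, mul_cyclicFrame_eq_mul_companion]
  have hform : formCongr τ P (Matrix.of fun i j : Fin 2 => if i.val + j.val + 1 = 2 then (1 : F) else 0) =
      !![0, ϖ ^ (-m) * ϖ ^ (-m) * (γ : Matrix (Fin 2) (Fin 2) F) 1 0; τ (ϖ ^ (-m) * ϖ ^ (-m) * (γ : Matrix (Fin 2) (Fin 2) F) 1 0), 0] := by
    have hms : (((ϖ ^ (-m)) • (!![1, (γ : Matrix (Fin 2) (Fin 2) F) 0 0; 0, (γ : Matrix (Fin 2) (Fin 2) F) 1 0] : Matrix (Fin 2) (Fin 2) F)).map τ) =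
        τ (ϖ ^ (-m)) • (!![1, (γ : Matrix (Fin 2) (Fin 2) F) 0 0; 0, (γ : Matrix (Fin 2) (Fin 2) F) 1 0] : Matrix (Fin 2) (Fin 2) F).map τ :=
      Matrix.map_smul' _ _ _ (fun a b => map_mul τ a b)
    rw [formCongr, hP, hms, hτlam, Matrix.transpose_smul, Matrix.smul_mul, Matrix.smul_mul, Matrix.mul_smul,
      formCongr_cyclicFrame_eq_antidiag τ hAu, smul_smul, map_mul, map_mul, hτlam]
    ext i j
    fin_cases i <;> fin_cases j <;> simp [mul_assoc]
  refine ⟨P, P⁻¹ * γ * P, ϖ ^ (-m) * ϖ ^ (-m) * (γ : Matrix (Fin 2) (Fin 2) F) 1 0, e, hβ0, he1, rfl, ?_, hform, ?_, ?_, ?_⟩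
  · rw [Units.val_mul, Units.val_mul, hP]
    have hinv : ((P⁻¹ : GL (Fin 2) F) : Matrix (Fin 2) (Fin 2) F) *
        ((ϖ ^ (-m)) • !![1, (γ : Matrix (Fin 2) (Fin 2) F) 0 0; 0, (γ : Matrix (Fin 2) (Fin 2) F) 1 0]) = 1 := by
      rw [← hP]; exact Units.inv_mul P
    rw [Matrix.mul_assoc, hcomp, ← Matrix.mul_assoc, hinv, Matrix.one_mul]
  · rw [map_mul, map_mul, hk, ← map_mul, ← map_mul, ← zpow_add₀ hϖ0, ← zpow_natCast, ← zpow_add₀ hϖ0]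
    congr 2
    omega
  · have h := apply_mul_map_trace_add_eq_zero τ hAu
    rw [map_mul, map_mul, hτlam]
    linear_combination ϖ ^ (-m) * ϖ ^ (-m) * h
  · rw [ncard_selfDualStable_congr τ _ γ P, hform]

end Field

/-! ## §2 At the CM place: rescaling to `v(β) = v(ϖ_v^e)`, `e ∈ {0,1}`, and the transported count -/

section CM

variable (L : Type) [Field L] [NumberField L] [IsCMField L] (v : HeightOneSpectrum (𝓞 ↥(maximalRealSubfield L)))
  (w : PlacesOver L v) (hw : IsCMField.complexConj L • w.1 = w.1)

omit [IsCMField L] in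
/-- The local form `(Φ₂)_w` is the literal `antidiag(1, 1)` over `L_w` (a public copy is ★ `placeForm_antidiagTwo_eq`, `CMLocalRankOneClassMapOpen`). [cite: Rogawski1990, §3.5 p. 29] -/
private theorem placeForm_antidiagTwo_eq_lit :
    placeForm (Matrix.of fun i j : Fin 2 => if i.val + j.val + 1 = 2 then (1 : L) else 0) w.1 =
      Matrix.of fun i j : Fin 2 => if i.val + j.val + 1 = 2 then (1 : w.1.adicCompletion L) else 0 := by
  rw [placeForm_antidiagOne, ← antidiagOne_eq_over]

include hw in
/-- **(β0′) THE ISOTROPIC CYCLIC FRAME AT THE CM PLACE, WITH THE TRANSPORTED COUNT.**  For `γ ∈ U(σ_w, (Φ₂)_w)(L_w)` whose characteristic polynomial has no root in `L_w`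
(`v` non-split, unramified in `L`), there are a frame `P ∈ GL₂(L_w)`, `β ∈ L_w^×` and `e ∈ {0,1}` with: `γ′ := P⁻¹ γ P` the COMPANION `[[0, −det γ], [1, tr γ]]`,
`H_P = ᵗσ(P)(Φ₂)_w P = [[0, β], [σβ, 0]]`, `v(β) = v(ϖ_v^e)` (`ϖ_v = ι_w(ϖ_v)` the `σ_w`-fixed uniformizer), the trace relation `β σ(tr γ) + σ(β) tr γ = 0`, and
`#S((Φ₂)_w, γ) = #S([[0, β], [σβ, 0]], γ′)` — the input frame of B-p10 (g24)'s (β2′-ii) count. [cite: Flicker1998UnitaryFL, p. 97] [cite: Rogawski1990, §3.6 p. 31] -/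
theorem exists_cyclicFrame_ncard_selfDualStable_eq (hunr : Algebra.IsUnramifiedIn (𝓞 L) v.asIdeal)
    (γ : GL (Fin 2) (w.1.adicCompletion L))
    (hγ : γ ∈ unitaryGroup (galAdicCompletionMap (L := L) (IsCMField.complexConj L) hw)
      (placeForm (Matrix.of fun i j : Fin 2 => if i.val + j.val + 1 = 2 then (1 : L) else 0) w.1))
    (hirr : ¬ ∃ x : w.1.adicCompletion L, ((γ : Matrix (Fin 2) (Fin 2) (w.1.adicCompletion L)).charpoly).IsRoot x) :
    ∃ (P γ' : GL (Fin 2) (w.1.adicCompletion L)) (β : w.1.adicCompletion L) (e : ℕ),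
      β ≠ 0 ∧ e ≤ 1 ∧ γ' = P⁻¹ * γ * P ∧
      (γ' : Matrix (Fin 2) (Fin 2) (w.1.adicCompletion L)) =
        !![0, -(γ : Matrix (Fin 2) (Fin 2) (w.1.adicCompletion L)).det; 1, (γ : Matrix (Fin 2) (Fin 2) (w.1.adicCompletion L)).trace] ∧
      formCongr (galAdicCompletionMap (L := L) (IsCMField.complexConj L) hw) P
          (placeForm (Matrix.of fun i j : Fin 2 => if i.val + j.val + 1 = 2 then (1 : L) else 0) w.1) =
        !![0, β; galAdicCompletionMap (L := L) (IsCMField.complexConj L) hw β, 0] ∧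
      Valued.v β = Valued.v (toPlace v w (HeckeCharacter.uniformizer ↥(maximalRealSubfield L) v : v.adicCompletion ↥(maximalRealSubfield L)) ^ e) ∧
      β * galAdicCompletionMap (L := L) (IsCMField.complexConj L) hw (γ : Matrix (Fin 2) (Fin 2) (w.1.adicCompletion L)).trace +
        galAdicCompletionMap (L := L) (IsCMField.complexConj L) hw β * (γ : Matrix (Fin 2) (Fin 2) (w.1.adicCompletion L)).trace = 0 ∧
      {Λ : Submodule 𝒪[w.1.adicCompletion L] (Fin 2 → w.1.adicCompletion L) |
          (∃ g : GL (Fin 2) (w.1.adicCompletion L),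
            (∃ J' ∈ glInt 2 (w.1.adicCompletion L), (J' : Matrix (Fin 2) (Fin 2) (w.1.adicCompletion L)) =
              formCongr (galAdicCompletionMap (L := L) (IsCMField.complexConj L) hw) g
                (placeForm (Matrix.of fun i j : Fin 2 => if i.val + j.val + 1 = 2 then (1 : L) else 0) w.1)) ∧
            Λ = Submodule.span 𝒪[w.1.adicCompletion L] (Set.range ((g : Matrix (Fin 2) (Fin 2) (w.1.adicCompletion L)))ᵀ)) ∧
          Λ.map ((Matrix.toLin' ((γ : GL (Fin 2) (w.1.adicCompletion L)) : Matrix (Fin 2) (Fin 2) (w.1.adicCompletion L))).restrictScalars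
            𝒪[w.1.adicCompletion L]) = Λ}.ncard =
      {Λ : Submodule 𝒪[w.1.adicCompletion L] (Fin 2 → w.1.adicCompletion L) |
          (∃ g : GL (Fin 2) (w.1.adicCompletion L),
            (∃ J' ∈ glInt 2 (w.1.adicCompletion L), (J' : Matrix (Fin 2) (Fin 2) (w.1.adicCompletion L)) =
              formCongr (galAdicCompletionMap (L := L) (IsCMField.complexConj L) hw) g
                !![0, β; galAdicCompletionMap (L := L) (IsCMField.complexConj L) hw β, 0]) ∧
            Λ = Submodule.span 𝒪[w.1.adicCompletion L] (Set.range ((g : Matrix (Fin 2) (Fin 2) (w.1.adicCompletion L)))ᵀ)) ∧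
          Λ.map ((Matrix.toLin' ((γ' : GL (Fin 2) (w.1.adicCompletion L)) : Matrix (Fin 2) (Fin 2) (w.1.adicCompletion L))).restrictScalars
            𝒪[w.1.adicCompletion L]) = Λ}.ncard := by
  rw [placeForm_antidiagTwo_eq_lit] at hγ ⊢
  have hϖ0 : toPlace v w (HeckeCharacter.uniformizer ↥(maximalRealSubfield L) v : v.adicCompletion ↥(maximalRealSubfield L)) ≠ 0 :=
    toPlace_uniformizer_ne_zero L v w hunr
  have hunif : ∀ x : w.1.adicCompletion L, x ≠ 0 → ∃ k : ℤ, valuation (w.1.adicCompletion L) x =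
      valuation (w.1.adicCompletion L) ((toPlace v w (HeckeCharacter.uniformizer ↥(maximalRealSubfield L) v : v.adicCompletion ↥(maximalRealSubfield L))) ^ k) := by
    intro x hx
    refine ⟨-WithZero.log (Valued.v x), (v_eq_iff_valuation_eq _ _).1 ?_⟩
    rw [valued_toPlace_uniformizer_zpow L v w hunr, neg_neg, WithZero.exp_log ((Valuation.ne_zero_iff _).2 hx)]
  obtain ⟨P, γ', β, e, hβ0, he1, hγ', hcomp, hform, hval, htr, hcount⟩ :=
    exists_cyclicFrame_ncard_selfDualStable_eq_of_uniformizer (galAdicCompletionMap (L := L) (IsCMField.complexConj L) hw)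
      (galAdicCompletionMap_toPlace_self L v w hw _) hϖ0 hunif γ hγ hirr
  exact ⟨P, γ', β, e, hβ0, he1, hγ', hcomp, hform, (v_eq_iff_valuation_eq _ _).2 hval, htr, hcount⟩

end CM

end Literature.NumberTheory.Automorphic.UnitaryGroup

end
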